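import Literature.NumberTheory.LFunctions.GaussianHeckeMoebius
import Literature.NumberTheory.LFunctions.GaussianHeckeLSeries
import Literature.NumberTheory.LFunctions.GaussianHeckeMeanValue
import HarnessLib

/-!
# The mollifier `M_X(s) = ∑_{N(d) ≤ X} μ(d) λ^m(d) N(d)^{-s}` of `D_m = 4 L(·, λ^m)` and the
# zero-detector coefficients `a = c_m ⋆ μ_{m,X}`

Topic `Literature/NumberTheory/LFunctions`, arithmetic half of the zero-detection step in the proof of
Ricci's zero-density estimate for the Hecke `L`-functions of `ℚ(i)`
(`Literature.NumberTheory.LFunctions.GaussianHecke.ricci_zeroDensity`; Montgomery's method, Ch. 12).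
For the continued Dirichlet series `D_m(s) = ∑_{z ≠ 0} λ^m(z) N(z)^{-s} = ∑_n c_m(n) n^{-s}`
(`GaussianHecke.heckeL`, `GaussianHecke.cCoeff`) and `X ≥ 1` we introduce THREE definitions

* `moebTrunc X z = ∑_{d ∈ ℤ[i]*, d ∣ z, N(d) ≤ X} μ(d)` (the truncated Möbius sum of the divisor classes;
  `μ` = Mathlib's `UniqueFactorizationMonoid.moebius` on `ℤ[i]`, `GaussianHeckeMoebius.lean`),
* `moebCoeff m X n = ∑_{d ∈ ℤ[i]*, N(d) = n, N(d) ≤ X} μ(d) λ^m(d)` (the coefficients of the MOLLIFIER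
  `M_X(s) = ∑_{d ∈ ℤ[i]*, N(d) ≤ X} μ(d) λ^m(d) N(d)^{-s} = L(moebCoeff m X, s)`, a Hecke polynomial),
* `detCoeff m X = c_m ⋆ moebCoeff m X` (Dirichlet convolution; the coefficients of `D_m · M_X`),

and PROVE

* `detCoeff_eq_sum` — `a(n) = ∑_{N(z) = n} λ^m(z) · moebTrunc X z` (the bijection `(x, d) ↦ (xd, d)`
  between `{N(x) N(d) = n}` and `{N(z) = n, d ∣ z}`);
* `detCoeff_one`, `detCoeff_eq_zero` — **`a(1) = 4`, `a(n) = 0` for `1 < n ≤ X`** (Möbius inversion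
  `GaussianHecke.sum_divisorsStar_moebius`), `norm_detCoeff_le` — `|a(n)| ≤ ∑_{N(z) = n} τ⋆(z)`,
  `τ⋆(z) = #divisorsStar z`;
* `LSeries_moebCoeff_eq_sum` — `L(moebCoeff, s)` is the finite sum `M_X(s)`;
  `heckeL_mul_LSeries_moebCoeff` — **`D_m(s) · M_X(s) = L(detCoeff, s)`** and its absolute convergence
  for `Re s > 1` (Mathlib's `LSeries_convolution'`).

## References

* H. L. Montgomery, *Topics in Multiplicative Number Theory*, LNM 227 (1971), Ch. 12. [Montgomery1971]
* E. C. Titchmarsh, *The Theory of the Riemann Zeta-Function*, 2nd ed. (1986), §9.16. [Titchmarsh1986]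
-/

noncomputable section

open Finset LSeries UniqueFactorizationMonoid Complex

namespace Literature.NumberTheory.LFunctions

namespace GaussianHecke

open GaussianInt GaussianTheta
open Literature.NumberTheory.QuadraticFields.GaussianPrimary (norm_pow')

open scoped Classical
open scoped LSeries.notation

/-! ### Definitions -/

/-- `moebTrunc X z = ∑_{d ∈ ℤ[i]*, d ∣ z, N(d) ≤ X} μ(d)` — the Möbius sum over the divisor classes of
`z` of norm at most `X` (for `N(z) ≤ X` this is `[z unit]`). [cite: Montgomery1971, Ch. 12] -/
def moebTrunc (X : ℝ) (z : _root_.GaussianInt) : ℤ :=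
  ∑ d ∈ (divisorsStar z).filter (fun d ↦ (d.norm : ℝ) ≤ X), moebius d

/-- `moebCoeff m X n = ∑_{d ∈ ℤ[i]*, N(d) = n, N(d) ≤ X} μ(d) λ^m(d)` — the `n`-th coefficient of the
mollifier `M_X(s) = ∑_{d ∈ ℤ[i]*, N(d) ≤ X} μ(d) λ^m(d) N(d)^{-s}`. [cite: Montgomery1971, Ch. 12] -/
def moebCoeff (m : ℕ) (X : ℝ) (n : ℕ) : ℂ :=
  ∑ d ∈ (normLEStar X).filter (fun d : _root_.GaussianInt ↦ d.norm = (n : ℤ)),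
    (moebius d : ℂ) * angularChar m d

/-- `detCoeff m X = c_m ⋆ moebCoeff m X` — the coefficients of `D_m(s) M_X(s)` (the zero detector).
[cite: Montgomery1971, Ch. 12] -/
def detCoeff (m : ℕ) (X : ℝ) : ℕ → ℂ :=
  cCoeff m ⍟ moebCoeff m X

/-! ### The mollifier coefficients -/

/-- `moebCoeff m X n = 0` for `n > X`. [folklore] -/
theorem moebCoeff_eq_zero_of_lt {m : ℕ} {X : ℝ} {n : ℕ} (h : X < n) : moebCoeff m X n = 0 := by
  unfold moebCoeff
  refine sum_eq_zero fun d hd ↦ ?_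
  rw [mem_filter, mem_normLEStar] at hd
  exfalso
  have : (d.norm : ℝ) = n := by exact_mod_cast hd.2
  linarith [hd.1.1]

/-- `|moebCoeff m X n| ≤ #{d ∈ ℤ[i] : N(d) = n}`. [folklore] -/
theorem norm_moebCoeff_le (m : ℕ) (X : ℝ) (n : ℕ) : ‖moebCoeff m X n‖ ≤ (normEq n).card := by
  unfold moebCoeff
  have hsub : (normLEStar X).filter (fun d : _root_.GaussianInt ↦ d.norm = (n : ℤ)) ⊆ normEq n := by
    intro d hd
    rw [mem_filter] at hd
    exact mem_normEq.2 hd.2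
  calc ‖∑ d ∈ (normLEStar X).filter (fun d : _root_.GaussianInt ↦ d.norm = (n : ℤ)),
    (moebius d : ℂ) * angularChar m d‖
      ≤ ∑ d ∈ (normLEStar X).filter (fun d : _root_.GaussianInt ↦ d.norm = (n : ℤ)), ‖(moebius d : ℂ) * angularChar m d‖ :=
        norm_sum_le _ _
    _ ≤ ∑ d ∈ (normLEStar X).filter (fun d : _root_.GaussianInt ↦ d.norm = (n : ℤ)), (1 : ℝ) := by
        refine sum_le_sum fun d hd ↦ ?_
        rw [mem_filter, mem_normLEStar] at hd
        rw [norm_mul, norm_angularChar (ne_zero_of_mem_fq hd.1.2), mul_one, Complex.norm_intCast]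
        exact_mod_cast abs_moebius_le_one d
    _ = ((normLEStar X).filter (fun d : _root_.GaussianInt ↦ d.norm = (n : ℤ))).card := by simp
    _ ≤ (normEq n).card := by exact_mod_cast card_le_card hsub

/-- The mollifier is a Dirichlet POLYNOMIAL: its `L`-series converges (absolutely) everywhere. [folklore] -/
theorem LSeriesSummable_moebCoeff (m : ℕ) (X : ℝ) (s : ℂ) : LSeriesSummable (moebCoeff m X) s := by
  refine (LSeriesSummable_congr' s ?_).2 LSeriesSummable_zero
  filter_upwards [Filter.eventually_gt_atTop ⌈X⌉₊] with n hn
  have h : X < n := lt_of_le_of_lt (Nat.le_ceil X) (by exact_mod_cast hn)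
  simp [moebCoeff_eq_zero_of_lt h]

/-- **`L(moebCoeff m X, s) = M_X(s) = ∑_{d ∈ ℤ[i]*, N(d) ≤ X} μ(d) λ^m(d) N(d)^{-s}`** (a finite sum;
every `s`). [cite: Montgomery1971, Ch. 12] -/
theorem LSeries_moebCoeff_eq_sum (m : ℕ) (X : ℝ) (s : ℂ) :
    LSeries (moebCoeff m X) s =
      ∑ d ∈ normLEStar X, (moebius d : ℂ) * angularChar m d * ((d.norm.natAbs : ℕ) : ℂ) ^ (-s) := by
  have hsupp : ∀ n ∉ range (⌈X⌉₊ + 1), term (moebCoeff m X) s n = 0 := by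
    intro n hn
    rw [mem_range, not_lt] at hn
    have h : X < n := lt_of_le_of_lt (Nat.le_ceil X) (by exact_mod_cast (by omega : ⌈X⌉₊ < n))
    rw [term_def]
    split_ifs
    · rfl
    · rw [moebCoeff_eq_zero_of_lt h, zero_div]
  rw [LSeries, tsum_eq_sum hsupp]
  -- regroup the finite sum over `d` by `n = N(d)`
  have hmaps : ∀ d ∈ normLEStar X, d.norm.natAbs ∈ range (⌈X⌉₊ + 1) := by
    intro d hd
    rw [mem_normLEStar] at hd
    rw [mem_range, Nat.lt_succ_iff]
    have h1 : ((d.norm.natAbs : ℕ) : ℝ) ≤ X := by rw [natAbs_norm_real]; exact hd.1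
    have h2 : ((d.norm.natAbs : ℕ) : ℝ) ≤ ⌈X⌉₊ := h1.trans (Nat.le_ceil X)
    exact_mod_cast h2
  rw [← sum_fiberwise_of_maps_to hmaps]
  refine sum_congr rfl fun n _ ↦ ?_
  rw [term_def]
  split_ifs with hn0
  · -- `n = 0`: no `d ∈ ℤ[i]*` has norm `0`
    subst hn0
    symm
    refine sum_eq_zero fun d hd ↦ ?_
    rw [mem_filter, mem_normLEStar] at hd
    exfalso
    have := norm_pos_of_mem_firstQuadrant hd.1.2
    omega
  · have hfil : (normLEStar X).filter (fun d : _root_.GaussianInt ↦ d.norm.natAbs = n) =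
        (normLEStar X).filter (fun d : _root_.GaussianInt ↦ d.norm = (n : ℤ)) := by
      refine filter_congr fun d _ ↦ ?_
      constructor
      · intro h; rw [← h]; exact (natAbs_norm_cast d).symm
      · intro h; have := natAbs_norm_cast d; omega
    rw [hfil, moebCoeff, sum_div]
    refine sum_congr rfl fun d hd ↦ ?_
    rw [mem_filter] at hd
    have hdn : d.norm.natAbs = n := by have := natAbs_norm_cast d; omega
    rw [hdn, cpow_neg, div_eq_mul_inv]

/-- For `Re s > 1` the product `D_m(s) · M_X(s)` is the (absolutely convergent) `L`-series of
`detCoeff m X = c_m ⋆ moebCoeff m X`. [cite: Montgomery1971, Ch. 12] -/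
theorem heckeL_mul_LSeries_moebCoeff (m : ℕ) (X : ℝ) {s : ℂ} (hs : 1 < s.re) :
    heckeL m s * LSeries (moebCoeff m X) s = LSeries (detCoeff m X) s := by
  rw [heckeL_eq_LSeries m hs, detCoeff]
  exact (LSeries_convolution' (LSeriesSummable_cCoeff m hs) (LSeriesSummable_moebCoeff m X s)).symm

/-- Absolute convergence of `∑ detCoeff(n) n^{-s}` for `Re s > 1`. [folklore] -/
theorem LSeriesSummable_detCoeff (m : ℕ) (X : ℝ) {s : ℂ} (hs : 1 < s.re) :
    LSeriesSummable (detCoeff m X) s :=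
  (LSeriesSummable_cCoeff m hs).convolution (LSeriesSummable_moebCoeff m X s)

/-! ### The coefficients of the zero detector -/

/-- The pairs `(x, d)` with `x ∈ ℤ[i]`, `d ∈ ℤ[i]*`, `N(d) ≤ X`, `N(x) N(d) = n`. [folklore] -/
theorem mem_pairsL {X : ℝ} {n : ℕ} {q : _root_.GaussianInt × _root_.GaussianInt} :
    q ∈ (normLE (n : ℝ) ×ˢ normLEStar X).filter (fun q ↦ q.1.norm.natAbs * q.2.norm.natAbs = n) ↔
      q.1.norm ≤ n ∧ q.2 ∈ normLEStar X ∧ q.1.norm.natAbs * q.2.norm.natAbs = n := by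
  rw [mem_filter, mem_product, mem_normLE, and_assoc]
  exact ⟨fun ⟨h1, h2, h3⟩ ↦ ⟨by exact_mod_cast h1, h2, h3⟩, fun ⟨h1, h2, h3⟩ ↦ ⟨by exact_mod_cast h1, h2, h3⟩⟩

/-- `detCoeff m X n` as a sum over the pairs `(x, d)` with `N(x) N(d) = n`. [folklore] -/
theorem detCoeff_eq_sum_pairsL (m : ℕ) (X : ℝ) {n : ℕ} (hn : n ≠ 0) :
    detCoeff m X n = ∑ q ∈ (normLE (n : ℝ) ×ˢ normLEStar X).filter
        (fun q ↦ q.1.norm.natAbs * q.2.norm.natAbs = n),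
      angularChar m q.1 * ((moebius q.2 : ℂ) * angularChar m q.2) := by
  rw [detCoeff, convolution_def]
  dsimp only
  have hfib : ∀ de ∈ n.divisorsAntidiagonal,
      ((normLE (n : ℝ) ×ˢ normLEStar X).filter (fun q ↦ q.1.norm.natAbs * q.2.norm.natAbs = n)).filter
          (fun q ↦ (q.1.norm.natAbs, q.2.norm.natAbs) = de) =
        normEq de.1 ×ˢ (normLEStar X).filter (fun d : _root_.GaussianInt ↦ d.norm = (de.2 : ℤ)) := by
    rintro ⟨a, b⟩ hde
    obtain ⟨hmul, -⟩ := Nat.mem_divisorsAntidiagonal.mp hde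
    simp only at hmul
    have han : a ≤ n := Nat.le_of_dvd (Nat.pos_of_ne_zero hn) ⟨b, hmul.symm⟩
    ext ⟨x, d⟩
    simp only [mem_filter, mem_product, mem_normEq, mem_normLE, Prod.mk.injEq]
    constructor
    · rintro ⟨⟨⟨-, hd⟩, -⟩, hxa, hdb⟩
      refine ⟨?_, hd, ?_⟩
      · rw [← hxa]; exact (natAbs_norm_cast x).symm
      · rw [← hdb]; exact (natAbs_norm_cast d).symm
    · rintro ⟨hxa, hd, hdb⟩
      have hxa' : x.norm.natAbs = a := by have := natAbs_norm_cast x; omega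
      have hdb' : d.norm.natAbs = b := by have := natAbs_norm_cast d; omega
      refine ⟨⟨⟨?_, hd⟩, ?_⟩, hxa', hdb'⟩
      · rw [hxa]; exact_mod_cast han
      · rw [hxa', hdb', hmul]
  have hmaps : ∀ q ∈ (normLE (n : ℝ) ×ˢ normLEStar X).filter
      (fun q ↦ q.1.norm.natAbs * q.2.norm.natAbs = n),
      (q.1.norm.natAbs, q.2.norm.natAbs) ∈ n.divisorsAntidiagonal := fun q hq ↦
    Nat.mem_divisorsAntidiagonal.mpr ⟨(mem_pairsL.mp hq).2.2, hn⟩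
  rw [← sum_fiberwise_of_maps_to hmaps]
  refine sum_congr rfl fun de hde ↦ ?_
  rw [hfib de hde, cCoeff, moebCoeff, sum_mul_sum, sum_product]

/-- For `z ≠ 0`: the divisor classes of `z` of norm `≤ X` are the elements of `ℤ[i]* ∩ {N ≤ X}` dividing
`z`. [folklore] -/
theorem filter_divisorsStar_eq {X : ℝ} {z : _root_.GaussianInt} (hz : z ≠ 0) :
    (divisorsStar z).filter (fun d ↦ (d.norm : ℝ) ≤ X) = (normLEStar X).filter (fun d ↦ d ∣ z) := by
  ext d
  rw [mem_filter, mem_filter, mem_divisorsStar hz, mem_normLEStar]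
  tauto

/-- `∑_{N(z) = n} λ^m(z) · moebTrunc X z` as a sum over the pairs `(z, d)`, `d ∣ z`. [folklore] -/
theorem sum_normEq_mul_moebTrunc (m : ℕ) (X : ℝ) {n : ℕ} (hn : n ≠ 0) :
    ∑ z ∈ normEq n, angularChar m z * (moebTrunc X z : ℂ) =
      ∑ q ∈ (normEq n ×ˢ normLEStar X).filter (fun q ↦ q.2 ∣ q.1),
        angularChar m q.1 * (moebius q.2 : ℂ) := by
  rw [sum_filter, sum_product]
  refine sum_congr rfl fun z hz ↦ ?_
  rw [mem_normEq] at hz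
  have hz0 : z ≠ 0 := by
    rw [← GaussianInt.norm_eq_zero.ne, hz]; exact_mod_cast hn
  rw [moebTrunc, filter_divisorsStar_eq hz0, Int.cast_sum, mul_sum, sum_filter]

/-- **The coefficients of the zero detector:** for `n ≥ 1`,
`detCoeff m X n = ∑_{z ∈ ℤ[i], N(z) = n} λ^m(z) · moebTrunc X z`
(bijection `(x, d) ↦ (xd, d)` between `{N(x)N(d) = n}` and `{N(z) = n, d ∣ z}`; `λ^m(xd) = λ^m(x)λ^m(d)`).
[cite: Montgomery1971, Ch. 12] -/
theorem detCoeff_eq_sum (m : ℕ) (X : ℝ) {n : ℕ} (hn : n ≠ 0) :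
    detCoeff m X n = ∑ z ∈ normEq n, angularChar m z * (moebTrunc X z : ℂ) := by
  rw [detCoeff_eq_sum_pairsL m X hn, sum_normEq_mul_moebTrunc m X hn]
  refine sum_nbij' (fun q ↦ (q.1 * q.2, q.2)) (fun q ↦ (q.1 / q.2, q.2)) ?_ ?_ ?_ ?_ ?_
  · rintro ⟨x, d⟩ hq
    obtain ⟨hx, hd, hprod⟩ := mem_pairsL.mp hq
    refine mem_filter.2 ⟨mem_product.2 ⟨mem_normEq.2 ?_, hd⟩, dvd_mul_left _ _⟩
    show (x * d).norm = n
    rw [Zsqrtd.norm_mul, ← natAbs_norm_cast x, ← natAbs_norm_cast d]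
    exact_mod_cast hprod
  · rintro ⟨z, d⟩ hq
    rw [mem_filter, mem_product, mem_normEq] at hq
    obtain ⟨⟨hz, hd⟩, hdvd⟩ := hq
    have hd0 : d ≠ 0 := ne_zero_of_mem_fq (mem_normLEStar.1 hd).2
    have hzx : d * (z / d) = z := EuclideanDomain.mul_div_cancel' hd0 hdvd
    have hnorm : d.norm * (z / d).norm = n := by rw [← Zsqrtd.norm_mul, hzx, hz]
    have hNd : 0 < d.norm := GaussianInt.norm_pos.mpr hd0
    have hNx : 0 ≤ (z / d).norm := GaussianInt.norm_nonneg _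
    refine mem_pairsL.mpr ⟨?_, hd, ?_⟩
    · show (z / d).norm ≤ n
      nlinarith
    · show (z / d).norm.natAbs * d.norm.natAbs = n
      have h1 := natAbs_norm_cast (z / d)
      have h2 := natAbs_norm_cast d
      have : (((z / d).norm.natAbs * d.norm.natAbs : ℕ) : ℤ) = n := by
        rw [Nat.cast_mul, h1, h2, mul_comm, hnorm]
      exact_mod_cast this
  · rintro ⟨x, d⟩ hq
    have hd0 : d ≠ 0 := ne_zero_of_mem_fq (mem_normLEStar.1 (mem_pairsL.mp hq).2.1).2
    simp only [Prod.mk.injEq, and_true]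
    exact mul_div_cancel_right₀ x hd0
  · rintro ⟨z, d⟩ hq
    rw [mem_filter, mem_product] at hq
    obtain ⟨⟨-, hd⟩, hdvd⟩ := hq
    have hd0 : d ≠ 0 := ne_zero_of_mem_fq (mem_normLEStar.1 hd).2
    simp only [Prod.mk.injEq, and_true]
    rw [mul_comm]
    exact EuclideanDomain.mul_div_cancel' hd0 hdvd
  · rintro ⟨x, d⟩ _
    simp only
    rw [angularChar_mul]
    ring

/-- For a unit `u` and `X ≥ 1`: `moebTrunc X u = 1`. [folklore] -/
theorem moebTrunc_of_isUnit {X : ℝ} (hX : 1 ≤ X) {u : _root_.GaussianInt} (hu : IsUnit u) :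
    moebTrunc X u = 1 := by
  rw [moebTrunc, divisorsStar_of_isUnit hu]
  have h : ({1} : Finset _root_.GaussianInt).filter (fun d ↦ (d.norm : ℝ) ≤ X) = {1} := by
    ext d
    simp only [mem_filter, mem_singleton]
    constructor
    · exact fun h ↦ h.1
    · rintro rfl; exact ⟨rfl, by simpa using hX⟩
  rw [h, sum_singleton, moebius_one]

/-- For `z ≠ 0` with `N(z) ≤ X`: `moebTrunc X z = [z unit]` (Möbius inversion over `ℤ[i]*`). [folklore] -/
theorem moebTrunc_of_norm_le {X : ℝ} {z : _root_.GaussianInt} (hz : z ≠ 0) (hzX : (z.norm : ℝ) ≤ X) :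
    moebTrunc X z = if IsUnit z then 1 else 0 := by
  rw [moebTrunc, ← sum_divisorsStar_moebius hz]
  refine sum_congr ?_ fun _ _ ↦ rfl
  ext d
  rw [mem_filter, and_iff_left_iff_imp]
  intro hd
  have := norm_le_norm_of_dvd ((mem_divisorsStar hz).1 hd).2 hz
  exact le_trans (by exact_mod_cast this) hzX

/-- **`detCoeff m X 1 = 4`** (`X ≥ 1`): the four units `z`, each with `λ^m(z) = 1` and
`moebTrunc X z = μ(1) = 1`. [cite: Montgomery1971, Ch. 12] -/
theorem detCoeff_one (m : ℕ) {X : ℝ} (hX : 1 ≤ X) : detCoeff m X 1 = 4 := by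
  rw [detCoeff_eq_sum m X one_ne_zero]
  have hterm : ∀ z ∈ normEq 1, angularChar m z * (moebTrunc X z : ℂ) = 1 := by
    intro z hz
    rw [mem_normEq] at hz
    have hu : IsUnit z := isUnit_iff_norm_eq_one.2 (by exact_mod_cast hz)
    rw [angularChar_unit m hu, moebTrunc_of_isUnit hX hu]
    simp
  rw [sum_congr rfl hterm, sum_const, nsmul_eq_mul, mul_one, ← cCoeff_one m, cCoeff]
  rw [sum_congr rfl fun z hz ↦ angularChar_unit m (isUnit_iff_norm_eq_one.2
    (by exact_mod_cast mem_normEq.1 hz)), sum_const, nsmul_eq_mul, mul_one]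

/-- **`detCoeff m X n = 0` for `1 < n ≤ X`**: every `z` with `N(z) = n` has all its divisor classes of
norm `≤ n ≤ X`, so `moebTrunc X z = ∑_{d ∣ z} μ(d) = 0`, `z` being a non-unit (Möbius inversion,
`GaussianHecke.sum_divisorsStar_moebius`). [cite: Montgomery1971, Ch. 12] -/
theorem detCoeff_eq_zero (m : ℕ) {X : ℝ} {n : ℕ} (h1 : 1 < n) (hX : (n : ℝ) ≤ X) : detCoeff m X n = 0 := by
  rw [detCoeff_eq_sum m X (by omega)]
  refine sum_eq_zero fun z hz ↦ ?_
  rw [mem_normEq] at hz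
  have hz0 : z ≠ 0 := by
    rw [← GaussianInt.norm_eq_zero.ne, hz]; exact_mod_cast (by omega : n ≠ 0)
  have hzX : (z.norm : ℝ) ≤ X := by rw [hz]; exact_mod_cast hX
  have hnu : ¬ IsUnit z := by
    rw [isUnit_iff_norm_eq_one, hz]; exact_mod_cast h1.ne'
  rw [moebTrunc_of_norm_le hz0 hzX, if_neg hnu]
  simp

/-- `|moebTrunc X z| ≤ τ⋆(z) = #divisorsStar z`. [folklore] -/
theorem abs_moebTrunc_le (X : ℝ) (z : _root_.GaussianInt) : |moebTrunc X z| ≤ (divisorsStar z).card := by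
  unfold moebTrunc
  calc |∑ d ∈ (divisorsStar z).filter (fun d ↦ (d.norm : ℝ) ≤ X), moebius d|
      ≤ ∑ d ∈ (divisorsStar z).filter (fun d ↦ (d.norm : ℝ) ≤ X), |moebius d| := abs_sum_le_sum_abs _ _
    _ ≤ ∑ d ∈ (divisorsStar z).filter (fun d ↦ (d.norm : ℝ) ≤ X), (1 : ℤ) :=
        sum_le_sum fun d _ ↦ abs_moebius_le_one d
    _ = ((divisorsStar z).filter (fun d ↦ (d.norm : ℝ) ≤ X)).card := by simp
    _ ≤ (divisorsStar z).card := by exact_mod_cast card_le_card (filter_subset _ _)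

/-- **`|detCoeff m X n| ≤ ∑_{N(z) = n} τ⋆(z)`** (`n ≥ 1`). [cite: Montgomery1971, Ch. 12] -/
theorem norm_detCoeff_le (m : ℕ) (X : ℝ) {n : ℕ} (hn : n ≠ 0) :
    ‖detCoeff m X n‖ ≤ ∑ z ∈ normEq n, ((divisorsStar z).card : ℝ) := by
  rw [detCoeff_eq_sum m X hn]
  refine (norm_sum_le _ _).trans (sum_le_sum fun z hz ↦ ?_)
  rw [mem_normEq] at hz
  have hz0 : z ≠ 0 := by
    rw [← GaussianInt.norm_eq_zero.ne, hz]; exact_mod_cast hn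
  rw [norm_mul, norm_angularChar hz0, one_mul, Complex.norm_intCast]
  exact_mod_cast abs_moebTrunc_le X z

end GaussianHecke

end Literature.NumberTheory.LFunctions
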